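import Summits.HubbardSuperconductivity.HubbardSuperconductivity.Theorems.BalabanIRBirComplexStableXYRHessianOrigin
import HarnessLib

/-!
# Crux `BirComplexStableXYR` (stmt-HubbardSuperconductivity-14845): the `K`-independent convexity
# radius of the admissible class

Support file (prover seat 0, route BalabanIR) for the restated engine
`…Theses.BalabanIR.BirComplexStableXYR`: the first lemma `ConvexityRadius` of idea card
`Cruxes/BirComplexStableXYR/Ideas/log-concave-core-bounded-phase.md`, with the Hessian form of the
window generating function `F(φ) = Σ_n c_n e^{i n·φ}` written out,

  `H_c(φ)v := -Σ_n c_n (n·v)² e^{i n·φ}`   (`= d²/dt² F(φ + tv)|₀`, see `…LogConcaveCore`).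

* `cvxr_norm_hess_sub_le` — (U1) + (A): `‖H_c(φ)v - H_c(ψ)v‖ ≤ 6·normA(c)·δ·ΣΣ(v_w - v_w')²` whenever
  `φ - ψ` oscillates by at most `δ` (`‖e^{in·φ} - e^{in·ψ}‖ ≤ |n·(φ-ψ)| ≤ |n|₁δ` by charge
  neutrality, `(n·v)² ≤ |n|₁² ΣΣ(v_w - v_w')²`, `|n|₁³ ≤ 6e^{|n|₁}`);
* `convexityRadius` — with `δ₀ := c₀/(24·max(B,0) + 1)`: for every table with (U1), (N), (A) `≤ B`,
  (C) with constant `c₀ > 0`, every `φ` of oscillation `≤ δ₀` and every direction `v`,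
  `c₀/4 · ΣΣ(v_w - v_w')² ≤ Re H_c(φ)v` and `|Im H_c(φ)v - Im H_c(0)v| ≤ c₀/4 · ΣΣ(v_w - v_w')²`
  (from `cvxr_re_hess_origin_ge` of `…HessianOrigin` plus the Lipschitz bound).

So `Re F` is uniformly convex transversally to the constants, and the imaginary Hessian is frozen at
its (real-symmetric) value at the constants, on a neighbourhood of the minimum set whose radius is set
by `(B, c₀)` once and does NOT shrink with the stiffness `K` — the class's own small/large-field
threshold.  Numerical sanity check of the statement on 36 random admissible `r = 2` tables: item
evidence `convexity_radius_check.out` (crux-ideate r1).  Consequences (convexity of `Re F` on the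
small-oscillation set, log-concavity of `|e^{-A}|` on the core of the torus) are in
`…BirComplexStableXYRLogConcaveCore`. [folklore]
-/

noncomputable section

namespace Summit.HubbardSuperconductivity.HubbardSuperconductivity.Theorems

open scoped BigOperators
open Summit.HubbardSuperconductivity.BirComplexStableXYNegative

section ConvexityRadius

variable {r : ℕ}

/-- Translating the base point by a constant does not change the pairing (U1). [folklore] -/
theorem cvxr_frq_add_const (n : Freq r) (hn : ∑ w, n w = 0) (φ : W r → ℝ) (a : ℝ) :
    (∑ w, (n w : ℝ) * (φ w + a)) = ∑ w, (n w : ℝ) * φ w := by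
  have hn' : (∑ w, (n w : ℝ)) = 0 := by exact_mod_cast hn
  calc (∑ w, (n w : ℝ) * (φ w + a)) = ∑ w, (n w : ℝ) * φ w + (∑ w, (n w : ℝ)) * a := by
        rw [Finset.sum_mul, ← Finset.sum_add_distrib]
        exact Finset.sum_congr rfl fun w _ => by ring
    _ = ∑ w, (n w : ℝ) * φ w := by rw [hn', zero_mul, add_zero]

/-- **(U1) pairing bound**: if `Σ_w n_w = 0` and the field `u` oscillates by at most `δ`
(`|u_w - u_w'| ≤ δ`), then `|n·u| ≤ |n|₁ δ`. [folklore] -/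
theorem cvxr_abs_frq_le (n : Freq r) (hn : ∑ w, n w = 0) (u : W r → ℝ) {δ : ℝ}
    (hu : ∀ w w', |u w - u w'| ≤ δ) :
    |∑ w, (n w : ℝ) * u w| ≤ (∑ w, |(n w : ℝ)|) * δ := by
  rcases isEmpty_or_nonempty (W r) with hW | ⟨⟨w₀⟩⟩
  · simp
  · have hn' : (∑ w, (n w : ℝ)) = 0 := by exact_mod_cast hn
    have e : ∑ w, (n w : ℝ) * u w = ∑ w, (n w : ℝ) * (u w - u w₀) := by
      have : ∑ w, (n w : ℝ) * (u w - u w₀) = ∑ w, (n w : ℝ) * u w - (∑ w, (n w : ℝ)) * u w₀ := by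
        rw [Finset.sum_mul, ← Finset.sum_sub_distrib]
        exact Finset.sum_congr rfl fun w _ => by ring
      rw [this, hn', zero_mul, sub_zero]
    rw [e]
    calc |∑ w, (n w : ℝ) * (u w - u w₀)| ≤ ∑ w, |(n w : ℝ) * (u w - u w₀)| :=
          Finset.abs_sum_le_sum_abs _ _
      _ = ∑ w, |(n w : ℝ)| * |u w - u w₀| := Finset.sum_congr rfl fun w _ => abs_mul _ _
      _ ≤ ∑ w, |(n w : ℝ)| * δ :=
          Finset.sum_le_sum fun w _ => mul_le_mul_of_nonneg_left (hu w w₀) (abs_nonneg _)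
      _ = (∑ w, |(n w : ℝ)|) * δ := (Finset.sum_mul _ _ _).symm

/-- A single squared difference is at most the complete Dirichlet form. [folklore] -/
theorem cvxr_sq_sub_le_dir (v : W r → ℝ) (w w' : W r) :
    (v w - v w') ^ 2 ≤ ∑ x, ∑ x', (v x - v x') ^ 2 := by
  calc (v w - v w') ^ 2 ≤ ∑ x', (v w - v x') ^ 2 :=
        Finset.single_le_sum (f := fun x' => (v w - v x') ^ 2) (fun x' _ => sq_nonneg _)
          (Finset.mem_univ w')
    _ ≤ ∑ x, ∑ x', (v x - v x') ^ 2 :=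
        Finset.single_le_sum (f := fun x => ∑ x', (v x - v x') ^ 2)
          (fun x _ => Finset.sum_nonneg fun x' _ => sq_nonneg _) (Finset.mem_univ w)

/-- `(n·v)² ≤ |n|₁² · ΣΣ (v_w - v_w')²` under (U1). [folklore] -/
theorem cvxr_frq_sq_le (n : Freq r) (hn : ∑ w, n w = 0) (v : W r → ℝ) :
    (∑ w, (n w : ℝ) * v w) ^ 2 ≤ (∑ w, |(n w : ℝ)|) ^ 2 * ∑ w, ∑ w', (v w - v w') ^ 2 := by
  set D := ∑ w, ∑ w', (v w - v w') ^ 2 with hD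
  have hDnn : 0 ≤ D := Finset.sum_nonneg fun _ _ => Finset.sum_nonneg fun _ _ => sq_nonneg _
  have hosc : ∀ w w', |v w - v w'| ≤ Real.sqrt D := fun w w' =>
    Real.abs_le_sqrt (cvxr_sq_sub_le_dir v w w')
  have h := cvxr_abs_frq_le n hn v hosc
  calc (∑ w, (n w : ℝ) * v w) ^ 2 = |∑ w, (n w : ℝ) * v w| ^ 2 := (sq_abs _).symm
    _ ≤ ((∑ w, |(n w : ℝ)|) * Real.sqrt D) ^ 2 := pow_le_pow_left₀ (abs_nonneg _) h 2
    _ = (∑ w, |(n w : ℝ)|) ^ 2 * D := by rw [mul_pow, Real.sq_sqrt hDnn]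

/-- `‖e^{ix} - e^{iy}‖ ≤ |x - y|`. [folklore] -/
theorem cvxr_norm_cexp_sub_cexp_le (x y : ℝ) :
    ‖Complex.exp (Complex.I * (x : ℂ)) - Complex.exp (Complex.I * (y : ℂ))‖ ≤ |x - y| := by
  have e : Complex.exp (Complex.I * (x : ℂ)) - Complex.exp (Complex.I * (y : ℂ)) =
      Complex.exp (Complex.I * (y : ℂ)) * (Complex.exp (Complex.I * ((x - y : ℝ) : ℂ)) - 1) := by
    rw [mul_sub, mul_one, ← Complex.exp_add]
    congr 1
    push_cast
    ring
  rw [e, norm_mul, Complex.norm_exp_I_mul_ofReal, one_mul]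
  have := Real.norm_exp_I_mul_ofReal_sub_one_le (x := x - y)
  simpa [Real.norm_eq_abs] using this

/-- **Lipschitz bound for the Hessian form** `H(φ)v = -Σ_n c_n (n·v)² e^{i n·φ}` of a table with
(U1): if `φ - ψ` oscillates by at most `δ ≥ 0` then
`‖H(φ)v - H(ψ)v‖ ≤ 6 · normA(c) · δ · ΣΣ (v_w - v_w')²`
(`‖e^{in·φ} - e^{in·ψ}‖ ≤ |n·(φ - ψ)| ≤ |n|₁ δ`, `(n·v)² ≤ |n|₁² ΣΣ(v_w - v_w')²`, `|n|₁³ ≤ 6 e^{|n|₁}`). [folklore] -/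
theorem cvxr_norm_hess_sub_le (c : Table r) (hU1 : ∀ n ∈ c.support, ∑ w, n w = 0)
    (φ ψ v : W r → ℝ) {δ : ℝ} (hδ0 : 0 ≤ δ)
    (hδ : ∀ w w', |(φ w - ψ w) - (φ w' - ψ w')| ≤ δ) :
    ‖(-c.sum (fun n a => a * (((∑ w, (n w : ℝ) * v w) ^ 2 : ℝ) : ℂ) *
          Complex.exp (Complex.I * ((∑ w, (n w : ℝ) * φ w : ℝ) : ℂ)))) -
      (-c.sum (fun n a => a * (((∑ w, (n w : ℝ) * v w) ^ 2 : ℝ) : ℂ) *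
          Complex.exp (Complex.I * ((∑ w, (n w : ℝ) * ψ w : ℝ) : ℂ))))‖ ≤
      6 * normA c * δ * ∑ w, ∑ w', (v w - v w') ^ 2 := by
  classical
  set D := ∑ w, ∑ w', (v w - v w') ^ 2 with hD
  have hDnn : 0 ≤ D := Finset.sum_nonneg fun _ _ => Finset.sum_nonneg fun _ _ => sq_nonneg _
  unfold Finsupp.sum normA
  rw [neg_sub_neg, ← Finset.sum_sub_distrib]
  -- pointwise bound
  have hpt : ∀ n ∈ c.support,
      ‖(c n * (((∑ w, (n w : ℝ) * v w) ^ 2 : ℝ) : ℂ) *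
            Complex.exp (Complex.I * ((∑ w, (n w : ℝ) * ψ w : ℝ) : ℂ)) -
          c n * (((∑ w, (n w : ℝ) * v w) ^ 2 : ℝ) : ℂ) *
            Complex.exp (Complex.I * ((∑ w, (n w : ℝ) * φ w : ℝ) : ℂ)))‖ ≤
        ‖c n‖ * Real.exp (∑ w, |(n w : ℝ)|) * (6 * δ * D) := by
    intro n hn
    have hn0 := hU1 n hn
    set A : ℝ := ∑ w, (n w : ℝ) * v w with hA
    set N1 : ℝ := ∑ w, |(n w : ℝ)| with hN1
    have hN1 : 0 ≤ N1 := Finset.sum_nonneg fun _ _ => abs_nonneg _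
    rw [← mul_sub, norm_mul, norm_mul, Complex.norm_real, Real.norm_eq_abs,
      abs_of_nonneg (sq_nonneg A)]
    -- the phase difference
    have hph : ‖Complex.exp (Complex.I * ((∑ w, (n w : ℝ) * ψ w : ℝ) : ℂ)) -
        Complex.exp (Complex.I * ((∑ w, (n w : ℝ) * φ w : ℝ) : ℂ))‖ ≤ N1 * δ := by
      refine (cvxr_norm_cexp_sub_cexp_le _ _).trans ?_
      have e : (∑ w, (n w : ℝ) * ψ w) - ∑ w, (n w : ℝ) * φ w = -∑ w, (n w : ℝ) * (φ w - ψ w) := by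
        rw [← Finset.sum_sub_distrib, ← Finset.sum_neg_distrib]
        exact Finset.sum_congr rfl fun w _ => by ring
      rw [e, abs_neg]
      exact cvxr_abs_frq_le n hn0 (fun w => φ w - ψ w) hδ
    have hA2 : A ^ 2 ≤ N1 ^ 2 * D := cvxr_frq_sq_le n hn0 v
    have hcube : N1 ^ 3 ≤ 6 * Real.exp N1 := by
      -- `x³/3! ≤ eˣ` (the tree's `SixVertex.cube_le_six_mul_exp`, inlined to keep imports light)
      have h := Real.pow_div_factorial_le_exp N1 hN1 3
      norm_num [Nat.factorial] at h
      linarith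
    calc ‖c n‖ * A ^ 2 * ‖Complex.exp (Complex.I * ((∑ w, (n w : ℝ) * ψ w : ℝ) : ℂ)) -
          Complex.exp (Complex.I * ((∑ w, (n w : ℝ) * φ w : ℝ) : ℂ))‖
        ≤ ‖c n‖ * (N1 ^ 2 * D) * (N1 * δ) := by
          apply mul_le_mul (mul_le_mul_of_nonneg_left hA2 (norm_nonneg _)) hph (norm_nonneg _)
          positivity
      _ = ‖c n‖ * N1 ^ 3 * (δ * D) := by ring
      _ ≤ ‖c n‖ * (6 * Real.exp N1) * (δ * D) := by
          apply mul_le_mul_of_nonneg_right _ (by positivity)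
          exact mul_le_mul_of_nonneg_left hcube (norm_nonneg _)
      _ = ‖c n‖ * Real.exp N1 * (6 * δ * D) := by ring
  calc ‖∑ n ∈ c.support, (c n * (((∑ w, (n w : ℝ) * v w) ^ 2 : ℝ) : ℂ) *
            Complex.exp (Complex.I * ((∑ w, (n w : ℝ) * ψ w : ℝ) : ℂ)) -
          c n * (((∑ w, (n w : ℝ) * v w) ^ 2 : ℝ) : ℂ) *
            Complex.exp (Complex.I * ((∑ w, (n w : ℝ) * φ w : ℝ) : ℂ)))‖
      ≤ ∑ n ∈ c.support, ‖(c n * (((∑ w, (n w : ℝ) * v w) ^ 2 : ℝ) : ℂ) *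
            Complex.exp (Complex.I * ((∑ w, (n w : ℝ) * ψ w : ℝ) : ℂ)) -
          c n * (((∑ w, (n w : ℝ) * v w) ^ 2 : ℝ) : ℂ) *
            Complex.exp (Complex.I * ((∑ w, (n w : ℝ) * φ w : ℝ) : ℂ)))‖ := norm_sum_le _ _
    _ ≤ ∑ n ∈ c.support, ‖c n‖ * Real.exp (∑ w, |(n w : ℝ)|) * (6 * δ * D) :=
        Finset.sum_le_sum hpt
    _ = 6 * (∑ n ∈ c.support, ‖c n‖ * Real.exp (∑ w, |(n w : ℝ)|)) * δ * D := by
        rw [← Finset.sum_mul]; ring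

/-- **The convexity radius of the admissible class** (idea card
`Cruxes/BirComplexStableXYR/Ideas/log-concave-core-bounded-phase.md`, first lemma `ConvexityRadius`,
with the Hessian form written out: `H_c(φ)v := -Σ_n c_n (n·v)² e^{i n·φ} = d²/dt² F(φ + tv)|₀`).
For every window side `r`, every `B` and every `c₀ > 0` there is `δ₀ > 0` (here
`δ₀ = c₀/(24·max(B,0) + 1)`, independent of the stiffness `K`) such that for every table `c` with
(U1) `Σ_w n_w = 0` on the support, (N) `Σ c_n = 0`, (A) `normA c ≤ B` and (C)
`c₀ ΣΣ(1 - cos(φ_w - φ_w')) ≤ Re F(φ)`, at every configuration `φ` of oscillation `≤ δ₀` and in every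
direction `v`: `c₀/4 · ΣΣ(v_w - v_w')² ≤ Re H_c(φ)v` (in fact `3c₀/4`) and
`|Im H_c(φ)v - Im H_c(0)v| ≤ c₀/4 · ΣΣ(v_w - v_w')²` — `Re F` is uniformly convex transversally to
the constants, and the imaginary Hessian is frozen at its value at the constants, on a `K`-independent
neighbourhood of the minimum set. [folklore] -/
theorem convexityRadius (r : ℕ) (B c₀ : ℝ) (hc₀ : 0 < c₀) :
    ∃ δ₀ : ℝ, 0 < δ₀ ∧ ∀ c : Table r,
      (∀ n ∈ c.support, ∑ w, n w = 0) → c.sum (fun _ a => a) = 0 → normA c ≤ B →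
      (∀ φ : W r → ℝ, c₀ * ∑ w, ∑ w', (1 - Real.cos (φ w - φ w')) ≤ (genF c φ).re) →
      ∀ φ : W r → ℝ, (∀ w w', |φ w - φ w'| ≤ δ₀) → ∀ v : W r → ℝ,
        c₀ / 4 * ∑ w, ∑ w', (v w - v w') ^ 2 ≤
          (-c.sum (fun n a => a * (((∑ w, (n w : ℝ) * v w) ^ 2 : ℝ) : ℂ) *
              Complex.exp (Complex.I * ((∑ w, (n w : ℝ) * φ w : ℝ) : ℂ)))).re ∧
        |(-c.sum (fun n a => a * (((∑ w, (n w : ℝ) * v w) ^ 2 : ℝ) : ℂ) *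
              Complex.exp (Complex.I * ((∑ w, (n w : ℝ) * φ w : ℝ) : ℂ)))).im -
          (-c.sum (fun n a => a * (((∑ w, (n w : ℝ) * v w) ^ 2 : ℝ) : ℂ) *
              Complex.exp (Complex.I * ((∑ w, (n w : ℝ) * (fun _ => (0:ℝ)) w : ℝ) : ℂ)))).im| ≤
          c₀ / 4 * ∑ w, ∑ w', (v w - v w') ^ 2 := by
  classical
  refine ⟨c₀ / (24 * max B 0 + 1), div_pos hc₀ (by positivity), ?_⟩
  intro c hU1 hN hA hC φ hφ v
  set δ₀ : ℝ := c₀ / (24 * max B 0 + 1) with hδ₀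
  have hδ₀pos : 0 < δ₀ := div_pos hc₀ (by positivity)
  set D := ∑ w, ∑ w', (v w - v w') ^ 2 with hD
  have hDnn : 0 ≤ D := Finset.sum_nonneg fun _ _ => Finset.sum_nonneg fun _ _ => sq_nonneg _
  -- the Hessian at the origin, written without the phase factor
  have horigin : (-c.sum (fun n a => a * (((∑ w, (n w : ℝ) * v w) ^ 2 : ℝ) : ℂ) *
      Complex.exp (Complex.I * ((∑ w, (n w : ℝ) * (fun _ => (0:ℝ)) w : ℝ) : ℂ)))) =
      -c.sum (fun n a => a * (((∑ w, (n w : ℝ) * v w) ^ 2 : ℝ) : ℂ)) := by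
    congr 1
    refine Finsupp.sum_congr fun n _ => ?_
    simp
  -- Lipschitz from the origin and the second-order condition at the origin
  have hlip := cvxr_norm_hess_sub_le c hU1 φ (fun _ => (0:ℝ)) v hδ₀pos.le
    (fun w w' => by simpa using hφ w w')
  have hre0 := cvxr_re_hess_origin_ge c hc₀ hN hC v
  rw [← horigin] at hre0
  -- `6 · normA c · δ₀ ≤ c₀/4`
  have hsmall : 6 * normA c * δ₀ * D ≤ c₀ / 4 * D := by
    refine mul_le_mul_of_nonneg_right ?_ hDnn
    have hnA : normA c ≤ max B 0 := hA.trans (le_max_left _ _)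
    have hm : 0 ≤ max B 0 := le_max_right _ _
    have hn0 : 0 ≤ normA c := normA_nonneg c
    have h1 : 6 * normA c * δ₀ ≤ 6 * max B 0 * δ₀ :=
      mul_le_mul_of_nonneg_right (by linarith) hδ₀pos.le
    have h2 : 6 * max B 0 * δ₀ ≤ c₀ / 4 := by
      rw [hδ₀, mul_div_assoc', div_le_iff₀ (by positivity)]
      nlinarith
    linarith
  set Hφ := -c.sum (fun n a => a * (((∑ w, (n w : ℝ) * v w) ^ 2 : ℝ) : ℂ) *
      Complex.exp (Complex.I * ((∑ w, (n w : ℝ) * φ w : ℝ) : ℂ))) with hHφ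
  set H0 := -c.sum (fun n a => a * (((∑ w, (n w : ℝ) * v w) ^ 2 : ℝ) : ℂ) *
      Complex.exp (Complex.I * ((∑ w, (n w : ℝ) * (fun _ => (0:ℝ)) w : ℝ) : ℂ))) with hH0
  have hnorm : ‖Hφ - H0‖ ≤ c₀ / 4 * D := hlip.trans hsmall
  constructor
  · have h1 : |(Hφ - H0).re| ≤ ‖Hφ - H0‖ := Complex.abs_re_le_norm _
    rw [Complex.sub_re] at h1
    have h2 := (abs_le.1 (h1.trans hnorm)).1
    have h3 : 0 ≤ c₀ * D := mul_nonneg hc₀.le hDnn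
    rw [← hD] at hre0
    linarith
  · have h1 : |(Hφ - H0).im| ≤ ‖Hφ - H0‖ := Complex.abs_im_le_norm _
    rw [Complex.sub_im] at h1
    exact h1.trans hnorm

end ConvexityRadius

end Summit.HubbardSuperconductivity.HubbardSuperconductivity.Theorems
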